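import Mathlib
import HarnessLib
import Summits.NavierStokesRegularity.NavierStokesRegularity.Theorems.PoloidalWindowDoorPoloidalWindowRigiditySparseEnergyScaledApex
import Summits.NavierStokesRegularity.NavierStokesRegularity.Theorems.PoloidalWindowDoorPoloidalWindowRigiditySparseEnergyScaledCubic
import Summits.NavierStokesRegularity.NavierStokesRegularity.Theorems.PoloidalWindowDoorPoloidalWindowRigiditySparseEnergyScaledPressureD

/-!
# Route `PoloidalWindowDoor`, crux `PoloidalWindowRigidity` (stmt-19708), line `sparse_energy` — THE CKN SCALED PACKAGE OF THE TYPE-I CLASS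
# (one citable statement)

Seat ns-poloidal-K2-p2 g10 (LEAD-lineage on 19708; file `--supports`).  `typeI_scaledQuantities` bundles, for a profile of the route's
Type-I ancient mild class (Type-I time decay `C`, continuity, Oseen mildness, divergence-free slices), ONE set of constants `K, K₃, D₀ ≥ 0` with,
for all centres `a`, radii `R > 0` and apex times `t₀ ≤ 0`:

* (A)  `∫⁻_{B_R(a)} |v(t)|² ≤ K·R` for every `t < 0`                                   (`…ScaledEnergy.scaledEnergy`, S1);
* (E)  `∫⁻_{t<0} ∫⁻_{B_R(a)} |∇v|² ≤ K·R`                                               (`…ScaledApex.scaledDissipation_apex`);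
* (C)  `∫⁻_{t₀−R²<t<t₀} ∫⁻_{B_R(a)} |v|³ ≤ K₃·R²`                                        (`…ScaledCubic.scaledCubic`);
* (D)  for every window `(T,0)` a classical pressure `q` with `∫⁻∫⁻_{Q_R(a,t₀)} (√|q − c(t)|)³ ≤ D₀·R²` whenever `T ≤ t₀ − R²`
       (`…ScaledPressureD.scaledPressure_threeHalves`).

I.e. the class is «Type I in all four Caffarelli–Kohn–Nirenberg scaled quantities» at every scale, centre and apex time — the standing
hypothesis of the ε-regularity / Seregin-type blow-down theory (consumed e.g. by ns-idea-8's `period_door` squeeze engine).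

WHAT THIS IS NOT: not a claim about Navier–Stokes regularity (boundedness, not smallness); an a-priori estimate for hypothetical Type-I ancient
profiles (bears_on LADDER-NS N0 via crux 19708, line sparse_energy). [folklore]
-/

noncomputable section

-- the summit and its single sub-problem share the name (CONVENTIONS §1), as in every Theorems file
set_option linter.dupNamespace false

namespace Summit.NavierStokesRegularity.NavierStokesRegularity.Theorems.PoloidalWindowDoorPoloidalWindowRigiditySparseEnergyScaledPackage

open MeasureTheory Set Function Filter Topology Metric
open scoped ENNReal
open Literature.Analysis Literature.Analysis.FluidPDE
open Summit.NavierStokesRegularity.NavierStokesRegularity.Theorems.PoloidalWindowDoorPoloidalWindowRigiditySparseEnergyScaledApex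
open Summit.NavierStokesRegularity.NavierStokesRegularity.Theorems.PoloidalWindowDoorPoloidalWindowRigiditySparseEnergyScaledCubic
open Summit.NavierStokesRegularity.NavierStokesRegularity.Theorems.PoloidalWindowDoorPoloidalWindowRigiditySparseEnergyScaledPressureD

variable {C : ℝ} {v : ℝ → EuclideanSpace ℝ (Fin 3) → EuclideanSpace ℝ (Fin 3)}

/-- **THE CKN SCALED PACKAGE OF THE TYPE-I CLASS** (A: slice energies; E: past dissipation up to the apex; C: cubic norm; D: pressure
`3/2`-norm of the window pressures, modulo constants in time) — all bounded scale-invariantly at every centre, radius and apex time `t₀ ≤ 0`. [folklore] -/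
theorem typeI_scaledQuantities (hrate : HasTypeITimeDecay C v)
    (hcont : ContinuousOn (uncurry v) (Iio (0 : ℝ) ×ˢ univ))
    (hmild : ∀ s t : ℝ, s < t → t < 0 → ∀ x,
      v t x = UnboundedOperators.heatExtension (v s) (t - s) x - oseenDuhamel 1 s v v t x)
    (hdiv : ∀ t < 0, VectorCalculus.IsDivFree (v t)) :
    ∃ K K₃ D₀ : ℝ, 0 ≤ K ∧ 0 ≤ K₃ ∧ 0 ≤ D₀ ∧
      (∀ t < 0, ∀ (a : EuclideanSpace ℝ (Fin 3)) (R : ℝ), 0 < R →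
        (∫⁻ x in ball a R, ENNReal.ofReal (‖v t x‖ ^ 2)) ≤ ENNReal.ofReal (K * R)) ∧
      (∀ (a : EuclideanSpace ℝ (Fin 3)) (R : ℝ), 0 < R →
        (∫⁻ t in Iio (0 : ℝ), ∫⁻ x in ball a R, ENNReal.ofReal (‖fderiv ℝ (v t) x‖ ^ 2)) ≤ ENNReal.ofReal (K * R)) ∧
      (∀ t₀ : ℝ, t₀ ≤ 0 → ∀ (a : EuclideanSpace ℝ (Fin 3)) (R : ℝ), 0 < R →
        (∫⁻ t in Ioo (t₀ - R ^ 2) t₀, ∫⁻ x in ball a R, ENNReal.ofReal (‖v t x‖ ^ 3)) ≤ ENNReal.ofReal (K₃ * R ^ 2)) ∧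
      (∀ T : ℝ, T < 0 → ∃ q : ℝ → EuclideanSpace ℝ (Fin 3) → ℝ, IsClassicalNSSolutionOn (Ioo T 0) 1 0 v q ∧
        ∀ t₀ : ℝ, t₀ ≤ 0 → ∀ (a : EuclideanSpace ℝ (Fin 3)) (R : ℝ), 0 < R → T ≤ t₀ - R ^ 2 →
          ∃ c : ℝ → ℝ, (∫⁻ t in Ioo (t₀ - R ^ 2) t₀, ∫⁻ x in ball a R, ENNReal.ofReal (Real.sqrt |q t x - c t| ^ 3)) ≤
            ENNReal.ofReal (D₀ * R ^ 2)) := by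
  obtain ⟨K, hK0, hK, hE⟩ := scaledDissipation_apex hrate hcont hmild hdiv
  obtain ⟨K₃, hK₃0, hC⟩ := scaledCubic hrate hcont hmild hdiv
  obtain ⟨D₀, hD₀0, hD⟩ := scaledPressure_threeHalves hrate hcont hmild hdiv
  exact ⟨K, K₃, D₀, hK0, hK₃0, hD₀0, fun t ht a R hR => (hK t ht a R hR).1, hE, hC, hD⟩

end Summit.NavierStokesRegularity.NavierStokesRegularity.Theorems.PoloidalWindowDoorPoloidalWindowRigiditySparseEnergyScaledPackage

end
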